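import Summits.AnomalousDissipation.AnomalousDissipation.Theorems.WindLineWindLineReachesCalm
import Summits.AnomalousDissipation.AnomalousDissipation.Theorems.WindLineWindLineFeedsTarget

/-!
# Crux `CyclicWindLineLoud` (stmt-AnomalousDissipation-11415), line `birth` — the a-priori (ν-DEPENDENT) core of
# the anomaly stub `stub_windLineLoudIfBoundedCalm` (v1: `stub_boundedCalmCrossingsPowerFloor`): a power floor of order ν

Lead workfile (prover-line-stmt-AnomalousDissipation-11415-c1, cycle 1). What is PROVABLE about the loudness of bounded
calm steady Galerkin states of the cyclic force, with no hypothesis on reachability: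

* `norm_convectionCoeff_le_of_isTransversal` — the SHARP, resolution-independent bound on the convection symbol of a
  transversal family supported in `S`: `‖B_k(C, C)‖ ≤ 2π |k| Σ_{l∈S} ‖C_l‖²` (for `l + m = k` transversality gives
  `C_l · m = C_l · k`, then Cauchy–Schwarz and `2ab ≤ a² + b²` with the reindexing `l ↦ k - l`). The tree's
  `norm_convectionCoeff_le` carries the factor `#S · Σ_{m∈S} Σⱼ|mⱼ|` instead and is useless uniformly in `N`.
* `cycCoeff_e3` / `norm_cycCoeff_e3` — the force coefficient at `e₃ = (0,0,1)` is `(-i/2, 0, 0)`, of norm `1/2`.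
* `calmEnergy_ge_of_zero` — FIRST-SHELL BALANCE: a calm zero `c` of the Galerkin field on `freqBall N`, `N ≥ 1`, satisfies
  `1/2 ≤ 4π²ν ‖c_{e₃}‖ + 2π Σ‖c_k‖²`; hence with `Σ‖c_k‖² ≤ E`: `Σ‖c_k‖² ≥ (1/2 - 4π²ν√E)/(2π)`.
* `power_ge_of_calm_zero` — the energy identity at a zero (`sum_re_inner_galerkinRHS_eq`, the wind does no work) and
  `|k|² ≥ 1` off the mean mode give `Σ Re⟪ĝ_k, c_k⟫ = 4π²ν Σ|k|²‖c_k‖² ≥ 4π²ν Σ‖c_k‖²`, so every calm zero of energy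
  `≤ E` has power `≥ πν - 8π³ν²√E` — a floor of ORDER ν.
* `windLineLoudIfBoundedCalm_apriori` — the registered stub's matrix VERBATIM with `ε(ν) = πν/2` (and `E' = E`), at every
  `0 < ν ≤ 1/(16π²√E)` and EVERY `N ≥ 1`: the content of the stub is exactly the ν-UNIFORMITY of `ε` (the zeroth law for
  the steady states the wind reaches), for which nothing in print or in the tree gives a handle.

Sources: R. Temam, *Navier–Stokes Equations* (1979), Ch. II (1.29)–(1.30) (energy identity, a-priori bound);
P. Constantin, C. Foias, *Navier–Stokes Equations* (1988), Ch. 8 (8.5) (the Galerkin convection term);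
C. R. Doering, C. Foias, J. Fluid Mech. 467 (2002) (dissipation bounds in body-forced flows: the first-shell balance).
-/

-- `Summit.<Summit>.<Problem>` is the tree's mandated summit-side namespace (CONVENTIONS §2); for this
-- single-conjunct summit the two coincide, so the duplicate is deliberate.
set_option linter.dupNamespace false

noncomputable section

open scoped BigOperators InnerProductSpace ComplexConjugate
open Set Function Filter MeasureTheory

namespace Summit.AnomalousDissipation.AnomalousDissipation.Theorems.CyclicWindLineLoud.PowerFloor

open Literature.Analysis.FunctionSpaces Literature.Analysis.FunctionSpaces.Torus
open Literature.Analysis.FluidPDE Literature.Analysis.FluidPDE.Torus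
open Summit.AnomalousDissipation.AnomalousDissipation.Theorems.WindLineReachesCalm
open Summit.AnomalousDissipation.AnomalousDissipation.Theorems.WindLineCyclic

variable {d : Type*} [Fintype d]

/-! ## §1 The sharp transversal bound on the convection symbol -/

/-- `‖k‖ = √|k|²` for the complex frequency vector. [folklore] -/
theorem norm_freqVec (m : d → ℤ) : ‖freqVec m‖ = Real.sqrt (freqNormSq m) := by
  rw [EuclideanSpace.norm_eq, freqNormSq]
  congr 1
  refine Finset.sum_congr rfl fun i _ => ?_
  rw [freqVec_apply, Complex.norm_intCast, sq_abs]

/-- Cauchy–Schwarz for the pairing `c · m = Σⱼ cⱼ mⱼ`: `‖c · m‖ ≤ ‖c‖ √|m|²`. [folklore] -/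
theorem norm_sum_mul_intCast_le (c : EuclideanSpace ℂ d) (m : d → ℤ) :
    ‖∑ j, c j * (m j : ℂ)‖ ≤ ‖c‖ * Real.sqrt (freqNormSq m) := by
  have h : ∑ j, c j * (m j : ℂ) = inner ℂ (freqVec m) c := by
    rw [inner_freqVec_left]
    exact Finset.sum_congr rfl fun j _ => mul_comm _ _
  rw [h]
  calc ‖inner ℂ (freqVec m) c‖ ≤ ‖freqVec m‖ * ‖c‖ := norm_inner_le_norm _ _
    _ = ‖c‖ * Real.sqrt (freqNormSq m) := by rw [norm_freqVec, mul_comm]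

omit [Fintype d] in
/-- Transversality moves the pairing from `m` to `k = l + m`: if `l · c = 0` and `l + m = k` then
`c · m = c · k`. [folklore] -/
theorem sum_mul_eq_of_transversal [Fintype d] {c : EuclideanSpace ℂ d} {l m k : d → ℤ}
    (hc : ∑ j, (l j : ℂ) * c j = 0) (hlm : l + m = k) :
    ∑ j, c j * (m j : ℂ) = ∑ j, c j * (k j : ℂ) := by
  have hm : m = k - l := eq_sub_of_add_eq' hlm
  subst hm
  have hc' : ∑ j, c j * (l j : ℂ) = 0 := by
    rw [← hc]
    exact Finset.sum_congr rfl fun j _ => mul_comm _ _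
  simp only [Pi.sub_apply, Int.cast_sub, mul_sub, Finset.sum_sub_distrib, hc', sub_zero]

/-- Reindexing bound: for `g ≥ 0` vanishing off `S`, `Σ_{l∈S} g (k - l) ≤ Σ_{m∈S} g m`. [folklore] -/
theorem sum_comp_sub_le [DecidableEq d] (S : Finset (d → ℤ)) {g : (d → ℤ) → ℝ} (hg : ∀ m, 0 ≤ g m)
    (hg0 : ∀ m ∉ S, g m = 0) (k : d → ℤ) :
    ∑ l ∈ S, g (k - l) ≤ ∑ m ∈ S, g m := by
  classical
  have hinj : Set.InjOn (fun l : d → ℤ => k - l) S := fun a _ b _ h => by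
    simpa using h
  rw [← Finset.sum_image hinj]
  set T := S.image fun l => k - l with hT
  calc ∑ m ∈ T, g m ≤ ∑ m ∈ T ∪ S, g m :=
        Finset.sum_le_sum_of_subset_of_nonneg Finset.subset_union_left fun m _ _ => hg m
    _ = ∑ m ∈ S, g m := by
        symm
        refine Finset.sum_subset Finset.subset_union_right fun m hm hmS => hg0 m hmS

/-- **Sharp bound on the convection symbol of a transversal family.** For `C` transversal on `S` and vanishing
off `S`, `‖convectionCoeff S C C k‖ ≤ 2π √|k|² Σ_{l∈S} ‖C l‖²` — uniformly in the size of `S` (the bound behind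
`b(u,u,v) ≤ C‖u‖²‖∇v‖_∞` mode by mode). [folklore] -/
theorem norm_convectionCoeff_le_of_isTransversal [DecidableEq d] (S : Finset (d → ℤ))
    {C : (d → ℤ) → EuclideanSpace ℂ d} (hC : IsTransversal S C) (hC0 : ∀ m ∉ S, C m = 0) (k : d → ℤ) :
    ‖convectionCoeff S C C k‖ ≤ 2 * Real.pi * Real.sqrt (freqNormSq k) * ∑ l ∈ S, ‖C l‖ ^ 2 := by
  classical
  -- collapse the inner sum: only `m = k - l` contributes, and `C (k - l) = 0` off `S`
  have hinner : ∀ l ∈ S, (∑ m ∈ S, if l + m = k then (2 * Real.pi * Complex.I * ∑ j, C l j * (m j : ℂ)) • C m else 0) =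
      (2 * Real.pi * Complex.I * ∑ j, C l j * (k j : ℂ)) • C (k - l) := by
    intro l hl
    have hcong : ∀ m ∈ S, (if l + m = k then (2 * Real.pi * Complex.I * ∑ j, C l j * (m j : ℂ)) • C m else 0) =
        if m = k - l then (2 * Real.pi * Complex.I * ∑ j, C l j * (k j : ℂ)) • C m else 0 := by
      intro m _
      by_cases h : l + m = k
      · rw [if_pos h, if_pos (eq_sub_of_add_eq' h), sum_mul_eq_of_transversal (hC l hl) h]
      · rw [if_neg h, if_neg (fun h' => h (by rw [h']; abel))]
    rw [Finset.sum_congr rfl hcong, Finset.sum_ite_eq']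
    split_ifs with hmem
    · rfl
    · rw [hC0 _ hmem, smul_zero]
  rw [convectionCoeff_def, Finset.sum_congr rfl hinner]
  -- termwise norm bound
  have hterm : ∀ l ∈ S, ‖(2 * Real.pi * Complex.I * ∑ j, C l j * (k j : ℂ)) • C (k - l)‖ ≤
      2 * Real.pi * Real.sqrt (freqNormSq k) * (‖C l‖ * ‖C (k - l)‖) := by
    intro l _
    rw [norm_smul, norm_mul, norm_mul, norm_mul, Complex.norm_I, mul_one, Complex.norm_real, Complex.norm_ofNat,
      Real.norm_of_nonneg Real.pi_pos.le]
    have h1 := norm_sum_mul_intCast_le (C l) k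
    calc 2 * Real.pi * ‖∑ j, C l j * (k j : ℂ)‖ * ‖C (k - l)‖
        ≤ 2 * Real.pi * (‖C l‖ * Real.sqrt (freqNormSq k)) * ‖C (k - l)‖ := by gcongr
      _ = 2 * Real.pi * Real.sqrt (freqNormSq k) * (‖C l‖ * ‖C (k - l)‖) := by ring
  -- `Σ ‖C l‖ ‖C (k-l)‖ ≤ Σ ‖C l‖²`
  have hAMGM : ∑ l ∈ S, ‖C l‖ * ‖C (k - l)‖ ≤ ∑ l ∈ S, ‖C l‖ ^ 2 := by
    have h2 : ∑ l ∈ S, ‖C l‖ * ‖C (k - l)‖ ≤ ∑ l ∈ S, (‖C l‖ ^ 2 + ‖C (k - l)‖ ^ 2) / 2 :=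
      Finset.sum_le_sum fun l _ => by nlinarith [two_mul_le_add_sq ‖C l‖ ‖C (k - l)‖]
    have h3 : ∑ l ∈ S, ‖C (k - l)‖ ^ 2 ≤ ∑ m ∈ S, ‖C m‖ ^ 2 :=
      sum_comp_sub_le S (g := fun m => ‖C m‖ ^ 2) (fun m => sq_nonneg _)
        (fun m hm => by simp [hC0 m hm]) k
    rw [← Finset.sum_div, Finset.sum_add_distrib] at h2
    linarith
  calc ‖∑ l ∈ S, (2 * Real.pi * Complex.I * ∑ j, C l j * (k j : ℂ)) • C (k - l)‖
      ≤ ∑ l ∈ S, ‖(2 * Real.pi * Complex.I * ∑ j, C l j * (k j : ℂ)) • C (k - l)‖ := norm_sum_le _ _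
    _ ≤ ∑ l ∈ S, 2 * Real.pi * Real.sqrt (freqNormSq k) * (‖C l‖ * ‖C (k - l)‖) := Finset.sum_le_sum hterm
    _ = 2 * Real.pi * Real.sqrt (freqNormSq k) * ∑ l ∈ S, ‖C l‖ * ‖C (k - l)‖ := by rw [Finset.mul_sum]
    _ ≤ 2 * Real.pi * Real.sqrt (freqNormSq k) * ∑ l ∈ S, ‖C l‖ ^ 2 := by gcongr

/-! ## §2 The cyclic force: its coefficient at `e₃ = (0,0,1)` and the first-shell balance -/

/-- The Fourier coefficient of the cyclic force `(sin 2πx₃, sin 2πx₁, sin 2πx₂)` at `e₃ = (0, 0, 1)` is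
`(-i/2, 0, 0)` (`sin 2πt = (e₁(t) - e₋₁(t))/(2i)`). [folklore] -/
theorem cycCoeff_e3 :
    UnitAddTorus.mFourierCoeff (EuclideanSpace.complexify ∘ fun x : UnitAddTorus (Fin 3) =>
        !₂[(fourier 1 (x 2) : ℂ).im, (fourier 1 (x 0) : ℂ).im, (fourier 1 (x 1) : ℂ).im]) ![0, 0, 1] =
      !₂[-(Complex.I / 2), 0, 0] := by
  rw [cycForce_eq_realTrigPoly, mFourierCoeff_realTrigPoly_eq]
  have h1 : (![0, 0, 1] : Fin 3 → ℤ) ∈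
      ({![0, 0, 1], ![0, 0, -1], ![1, 0, 0], ![-1, 0, 0], ![0, 1, 0], ![0, -1, 0]} : Finset (Fin 3 → ℤ)) := by
    decide
  have h2 : -(![0, 0, 1] : Fin 3 → ℤ) ∈
      ({![0, 0, 1], ![0, 0, -1], ![1, 0, 0], ![-1, 0, 0], ![0, 1, 0], ![0, -1, 0]} : Finset (Fin 3 → ℤ)) := by
    decide
  rw [if_pos h1, if_pos h2]
  ext i
  fin_cases i <;>
    simp [EuclideanSpace.conjVec_apply, Matrix.cons_val_zero, Matrix.cons_val_one, Matrix.cons_val_two, map_ofNat]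
  ring

/-- `‖ĝ(e₃)‖ = 1/2` for the cyclic force. [folklore] -/
theorem norm_cycCoeff_e3 :
    ‖UnitAddTorus.mFourierCoeff (EuclideanSpace.complexify ∘ fun x : UnitAddTorus (Fin 3) =>
        !₂[(fourier 1 (x 2) : ℂ).im, (fourier 1 (x 0) : ℂ).im, (fourier 1 (x 1) : ℂ).im]) ![0, 0, 1]‖ = 1 / 2 := by
  rw [cycCoeff_e3, EuclideanSpace.norm_eq, Fin.sum_univ_three]
  simp only [Matrix.cons_val_zero, Matrix.cons_val_one, Matrix.cons_val_two, Matrix.head_cons, Matrix.tail_cons,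
    norm_neg, norm_div, Complex.norm_I, Complex.norm_ofNat, norm_zero]
  rw [show ((1 : ℝ) / 2) ^ 2 + (0 : ℝ) ^ 2 + (0 : ℝ) ^ 2 = (1 / 2) ^ 2 by ring, Real.sqrt_sq (by norm_num)]

/-- `e₃ = (0,0,1)` lies in every frequency ball of radius `N ≥ 1`. [folklore] -/
theorem e3_mem_freqBall {N : ℕ} (hN : 1 ≤ N) : (![0, 0, 1] : Fin 3 → ℤ) ∈ freqBall N := by
  rw [mem_freqBall]
  have h1 : freqNormSq (![0, 0, 1] : Fin 3 → ℤ) = 1 := by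
    simp [freqNormSq, Fin.sum_univ_three]
  rw [h1]
  have : (1 : ℝ) ≤ (N : ℝ) := by exact_mod_cast hN
  nlinarith

/-- The Fourier coefficients of the cyclic force on any frequency set `S` form a real solenoidal coefficient vector
(restated from `Theorems.CyclicWindLineLoud.FarShore.cycCoeff_mem_galerkinSubspace` to keep this file's imports
minimal). [folklore] -/
theorem cycCoeff_mem_galerkinSubspace' (S : Finset (Fin 3 → ℤ)) :
    (fun k : ↥S => UnitAddTorus.mFourierCoeff (EuclideanSpace.complexify ∘ fun x : UnitAddTorus (Fin 3) =>
        !₂[(fourier 1 (x 2) : ℂ).im, (fourier 1 (x 0) : ℂ).im, (fourier 1 (x 1) : ℂ).im]) (k : Fin 3 → ℤ)) ∈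
      galerkinSubspace S :=
  ⟨isRealCoeff_mFourierCoeff isSmooth_cycForce.integrable,
    isSolenoidalCoeff_restrict (isDivFree_cycForce.isTransversal_mFourierCoeff isSmooth_cycForce S)⟩

/-- **First-shell balance at a steady Galerkin state of the cyclic force.** For `N ≥ 1`, `S = freqBall N`, and a
zero `c ∈ galerkinSubspace S` of the Galerkin field driven by the cyclic force (any wind, any `ν`):
`1/2 = ‖ĝ(e₃)‖ ≤ 4π²|ν| ‖c(e₃)‖ + 2π Σ_k ‖c_k‖²` — the `e₃`-equation `ĝ(e₃) = 4π²ν c(e₃) + Π_{e₃} B_{e₃}(c,c)` with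
the sharp transversal bound on `B`. [folklore] -/
theorem half_le_of_zero {N : ℕ} (hN : 1 ≤ N) (ν : ℝ) {c : ↥(freqBall (d := Fin 3) N) → EuclideanSpace ℂ (Fin 3)}
    (hc : c ∈ galerkinSubspace (freqBall N))
    (hz : galerkinRHS (freqBall N) ν (fun k : ↥(freqBall (d := Fin 3) N) => UnitAddTorus.mFourierCoeff
      (EuclideanSpace.complexify ∘ fun x : UnitAddTorus (Fin 3) =>
        !₂[(fourier 1 (x 2) : ℂ).im, (fourier 1 (x 0) : ℂ).im, (fourier 1 (x 1) : ℂ).im]) (k : Fin 3 → ℤ)) c = 0) :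
    (1 : ℝ) / 2 ≤ 4 * Real.pi ^ 2 * |ν| * ‖c ⟨![0, 0, 1], e3_mem_freqBall hN⟩‖ +
      2 * Real.pi * ∑ k : ↥(freqBall (d := Fin 3) N), ‖c k‖ ^ 2 := by
  classical
  set g : ↥(freqBall (d := Fin 3) N) → EuclideanSpace ℂ (Fin 3) := fun k => UnitAddTorus.mFourierCoeff
      (EuclideanSpace.complexify ∘ fun x : UnitAddTorus (Fin 3) =>
        !₂[(fourier 1 (x 2) : ℂ).im, (fourier 1 (x 0) : ℂ).im, (fourier 1 (x 1) : ℂ).im]) (k : Fin 3 → ℤ) with hgdef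
  have he3 : (![0, 0, 1] : Fin 3 → ℤ) ∈ freqBall N := e3_mem_freqBall hN
  have hg : g ∈ galerkinSubspace (freqBall N) := cycCoeff_mem_galerkinSubspace' (freqBall N)
  -- the `e₃`-equation
  have hk := congr_fun hz ⟨![0, 0, 1], he3⟩
  rw [Pi.zero_apply, galerkinRHS_apply, galerkinField_def] at hk
  simp only [coeffExt_of_mem _ he3] at hk
  have hgT : ∑ i, ((![0, 0, 1] : Fin 3 → ℤ) i : ℂ) * g ⟨![0, 0, 1], he3⟩ i = 0 := hg.2 ⟨![0, 0, 1], he3⟩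
  rw [leraySym_sub, leraySym_of_transversal hgT, neg_add_eq_zero] at hk
  -- `hk : ν4π²|e₃|² • c e₃ = g e₃ - Π B`
  have hfreq : freqNormSq (![0, 0, 1] : Fin 3 → ℤ) = 1 := by simp [freqNormSq, Fin.sum_univ_three]
  set B := convectionCoeff (freqBall N) (coeffExt (freqBall N) c) (coeffExt (freqBall N) c) ![0, 0, 1] with hBdef
  have hgeq : g ⟨![0, 0, 1], he3⟩ = (((ν * (4 * Real.pi ^ 2 * 1) : ℝ)) : ℂ) • c ⟨![0, 0, 1], he3⟩ +
      leraySym ![0, 0, 1] B := by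
    rw [hfreq] at hk
    rw [hk, sub_add_cancel]
  have hB : ‖B‖ ≤ 2 * Real.pi * Real.sqrt (freqNormSq (![0, 0, 1] : Fin 3 → ℤ)) *
      ∑ l ∈ freqBall N, ‖coeffExt (freqBall N) c l‖ ^ 2 :=
    norm_convectionCoeff_le_of_isTransversal (freqBall N) hc.2.isTransversal_coeffExt
      (fun m hm => coeffExt_of_not_mem c hm) _
  rw [hfreq, Real.sqrt_one, mul_one, sum_coeffExt (fun _ v => ‖v‖ ^ 2) c] at hB
  have hnorm : ‖g ⟨![0, 0, 1], he3⟩‖ = 1 / 2 := norm_cycCoeff_e3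
  calc (1 : ℝ) / 2 = ‖g ⟨![0, 0, 1], he3⟩‖ := hnorm.symm
    _ ≤ ‖(((ν * (4 * Real.pi ^ 2 * 1) : ℝ)) : ℂ) • c ⟨![0, 0, 1], he3⟩‖ + ‖leraySym ![0, 0, 1] B‖ := by
        rw [hgeq]; exact norm_add_le _ _
    _ ≤ 4 * Real.pi ^ 2 * |ν| * ‖c ⟨![0, 0, 1], he3⟩‖ + 2 * Real.pi * ∑ k : ↥(freqBall (d := Fin 3) N), ‖c k‖ ^ 2 := by
        refine add_le_add (le_of_eq ?_) ((norm_leraySym_le _ _).trans hB)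
        rw [norm_smul, Complex.norm_real, Real.norm_eq_abs, abs_mul,
          abs_of_pos (by positivity : (0 : ℝ) < 4 * Real.pi ^ 2 * 1)]
        ring

/-! ## §3 The power floor of order ν -/

/-- **Power floor of order ν for bounded calm steady Galerkin states of the cyclic force.** For `ν > 0`, `N ≥ 1`,
a CALM (`c 0 = 0`) zero `c ∈ galerkinSubspace (freqBall N)` of the Galerkin field with total energy `Σ‖c_k‖² ≤ E`
receives injected power `Σ_k Re⟪ĝ_k, c_k⟫ ≥ πν - 8π³ν²√E`. Proof: energy identity at the zero
(`sum_re_inner_galerkinRHS_eq`) gives power `= 4π²ν Σ|k|²‖c_k‖² ≥ 4π²ν Σ‖c_k‖²` (calm, `|k|² ≥ 1` off the mean mode),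
and the first-shell balance (`half_le_of_zero`) gives `2π Σ‖c_k‖² ≥ 1/2 - 4π²ν√E`. [folklore] -/
theorem power_ge_of_calm_zero {N : ℕ} (hN : 1 ≤ N) {ν E : ℝ} (hν : 0 < ν)
    {c : ↥(freqBall (d := Fin 3) N) → EuclideanSpace ℂ (Fin 3)} (hc : c ∈ galerkinSubspace (freqBall N))
    (hz : galerkinRHS (freqBall N) ν (fun k : ↥(freqBall (d := Fin 3) N) => UnitAddTorus.mFourierCoeff
      (EuclideanSpace.complexify ∘ fun x : UnitAddTorus (Fin 3) =>
        !₂[(fourier 1 (x 2) : ℂ).im, (fourier 1 (x 0) : ℂ).im, (fourier 1 (x 1) : ℂ).im]) (k : Fin 3 → ℤ)) c = 0)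
    (hcalm : c ⟨0, zero_mem_freqBall N⟩ = 0) (hE : ∑ k : ↥(freqBall (d := Fin 3) N), ‖c k‖ ^ 2 ≤ E) :
    Real.pi * ν - 8 * Real.pi ^ 3 * ν ^ 2 * Real.sqrt E ≤
      ∑ k : ↥(freqBall (d := Fin 3) N), (inner ℂ (UnitAddTorus.mFourierCoeff
        (EuclideanSpace.complexify ∘ fun x : UnitAddTorus (Fin 3) =>
          !₂[(fourier 1 (x 2) : ℂ).im, (fourier 1 (x 0) : ℂ).im, (fourier 1 (x 1) : ℂ).im])
            ((k : ↥(freqBall (d := Fin 3) N)) : Fin 3 → ℤ)) (c k)).re := by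
  classical
  have hS : ∀ k ∈ freqBall (d := Fin 3) N, -k ∈ freqBall N := neg_mem_freqBall_of_mem
  have hg : IsRealCoeff (S := freqBall (d := Fin 3) N) (fun k => UnitAddTorus.mFourierCoeff
      (EuclideanSpace.complexify ∘ fun x : UnitAddTorus (Fin 3) =>
        !₂[(fourier 1 (x 2) : ℂ).im, (fourier 1 (x 0) : ℂ).im, (fourier 1 (x 1) : ℂ).im])
          ((k : ↥(freqBall (d := Fin 3) N)) : Fin 3 → ℤ)) :=
    isRealCoeff_mFourierCoeff isSmooth_cycForce.integrable
  -- energy identity at the zero: power = 4π²ν · Σ|k|²‖c_k‖²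
  have hid := sum_re_inner_galerkinRHS_eq ν hS hg hc
  rw [hz] at hid
  simp only [Pi.zero_apply, inner_zero_right, Complex.zero_re, Finset.sum_const_zero] at hid
  -- Σ|k|²‖c_k‖² ≥ Σ‖c_k‖² (calm)
  set A : ℝ := ∑ k : ↥(freqBall (d := Fin 3) N), ‖c k‖ ^ 2 with hA
  have hA0 : 0 ≤ A := Finset.sum_nonneg fun k _ => sq_nonneg _
  have hcalm' : ∑ k : ↥(freqBall (d := Fin 3) N), (if (k : Fin 3 → ℤ) = 0 then 0 else ‖c k‖ ^ 2) = A := by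
    refine Finset.sum_congr rfl fun k _ => ?_
    split_ifs with hk
    · have : k = ⟨0, zero_mem_freqBall N⟩ := Subtype.ext hk
      rw [this, hcalm, norm_zero]; ring
    · rfl
  have hZ : A ≤ ∑ k : ↥(freqBall (d := Fin 3) N), freqNormSq (k : Fin 3 → ℤ) * ‖c k‖ ^ 2 := by
    rw [← hcalm']; exact calmEnergy_le_sum_freqNormSq_mul c
  -- first shell
  have hshell := half_le_of_zero hN ν hc hz
  rw [abs_of_pos hν] at hshell
  have he3 : ‖c ⟨![0, 0, 1], e3_mem_freqBall hN⟩‖ ≤ Real.sqrt E := by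
    refine Real.le_sqrt_of_sq_le (le_trans ?_ hE)
    exact Finset.single_le_sum (f := fun k : ↥(freqBall (d := Fin 3) N) => ‖c k‖ ^ 2) (fun k _ => sq_nonneg _)
      (Finset.mem_univ _)
  have h1 : (1 : ℝ) / 2 ≤ 4 * Real.pi ^ 2 * ν * Real.sqrt E + 2 * Real.pi * A := by
    have : 4 * Real.pi ^ 2 * ν * ‖c ⟨![0, 0, 1], e3_mem_freqBall hN⟩‖ ≤ 4 * Real.pi ^ 2 * ν * Real.sqrt E :=
      mul_le_mul_of_nonneg_left he3 (by positivity)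
    linarith
  -- combine: power = ν·4π²·Σ|k|²‖c‖² ≥ 4π²ν A ≥ 2πν (1/2 - 4π²ν√E)
  have h2 : ν * (4 * Real.pi ^ 2 * A) ≤
      ν * (4 * Real.pi ^ 2 * ∑ k : ↥(freqBall (d := Fin 3) N), freqNormSq (k : Fin 3 → ℤ) * ‖c k‖ ^ 2) :=
    mul_le_mul_of_nonneg_left (mul_le_mul_of_nonneg_left hZ (by positivity)) hν.le
  have h3 : Real.pi * ν - 8 * Real.pi ^ 3 * ν ^ 2 * Real.sqrt E ≤ ν * (4 * Real.pi ^ 2 * A) := by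
    have hpi := Real.pi_pos
    nlinarith [mul_le_mul_of_nonneg_left h1 (by positivity : (0 : ℝ) ≤ 2 * Real.pi * ν)]
  linarith

/-! ## §4 The registered stub's matrix with `ε(ν) = πν/2` -/

/-- **The a-priori (ν-DEPENDENT) form of `stub_windLineLoudIfBoundedCalm`.** The registered stub's matrix VERBATIM
— IF the wind-line carries a calm state of energy `≤ E` THEN it carries a wind-line state of energy `≤ E'` and power
`≥ ε` — holds with `E' = E` and `ε = ε(ν) = πν/2` at EVERY `0 < ν ≤ 1/(16π²√E)` and EVERY resolution `N ≥ 1`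
(take the same state; `power_ge_of_calm_zero`). The stub asks for `ε` INDEPENDENT of `ν` (for `ν < ν₀(E)`, at
infinitely many `N`): that ν-uniformity, and nothing else, is its content. [folklore] -/
theorem windLineLoudIfBoundedCalm_apriori :
    ∀ E : ℝ, ∀ ν : ℝ, 0 < ν → 16 * Real.pi ^ 2 * ν * Real.sqrt E ≤ 1 → ∀ N : ℕ, 1 ≤ N → ∀ (S : Finset (Fin 3 → ℤ)), S = Literature.Analysis.FunctionSpaces.Torus.freqBall N → ∀ V : Set (↥S → EuclideanSpace ℂ (Fin 3)), V = {c | c ∈ Literature.Analysis.FluidPDE.galerkinSubspace S ∧ (∃ s : ℝ, ∀ k : ↥S, (k : Fin 3 → ℤ) = 0 → c k = (s : ℂ) • !₂[(1 : ℂ), ((Real.sqrt 2 : ℝ) : ℂ), ((Real.sqrt 3 : ℝ) : ℂ)]) ∧ Literature.Analysis.FluidPDE.galerkinRHS S ν (fun k : ↥S => UnitAddTorus.mFourierCoeff (Literature.Analysis.FunctionSpaces.EuclideanSpace.complexify ∘ fun x : UnitAddTorus (Fin 3) => !₂[(fourier 1 (x 2) : ℂ).im, (fourier 1 (x 0) :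 ℂ).im, (fourier 1 (x 1) : ℂ).im]) (k : Fin 3 → ℤ)) c = 0} → (∃ c ∈ V, (∀ k : ↥S, (k : Fin 3 → ℤ) = 0 → c k = 0) ∧ (∀ Λ : ℝ, ∃ c' ∈ connectedComponentIn V c, ∃ s : ℝ, (∀ k : ↥S, (k : Fin 3 → ℤ) = 0 → c' k = (s : ℂ) • !₂[(1 : ℂ), ((Real.sqrt 2 : ℝ) : ℂ), ((Real.sqrt 3 : ℝ) : ℂ)]) ∧ Λ ≤ s) ∧ ∑ k : ↥S, ‖c k‖ ^ 2 ≤ E) → ∃ c ∈ V, (∀ Λ : ℝ, ∃ c' ∈ connectedComponentIn V c, ∃ s : ℝ, (∀ k : ↥S, (k : Fin 3 → ℤ) = 0 → c' k = (s : ℂ) • !₂[(1 : ℂ), ((Real.sqrt 2 : ℝ) : ℂ), ((Real.sqrt 3 : ℝ) : ℂ)]) ∧ Λ ≤ s) ∧ ∑ k : ↥S, ‖c k‖ ^ 2 ≤ E ∧ Real.pi * ν / 2 ≤ ∑ k : ↥S, (inner ℂ (UnitAddTorus.mFourierCoeff (Literature.Analysis.FunctionSpaces.EuclideanSpace.complexify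 ∘ fun x : UnitAddTorus (Fin 3) => !₂[(fourier 1 (x 2) : ℂ).im, (fourier 1 (x 0) : ℂ).im, (fourier 1 (x 1) : ℂ).im]) ((k : ↥S) : Fin 3 → ℤ)) (c k)).re := by
  intro E ν hν hsmall N hN S hS V hV hex
  obtain ⟨c, hcV, hcalm, hwl, hE⟩ := hex
  refine ⟨c, hcV, hwl, hE, ?_⟩
  have hcV' := hcV
  rw [hV, Set.mem_setOf_eq] at hcV'
  obtain ⟨hc, -, hz⟩ := hcV'
  subst hS
  have h0 := hcalm ⟨0, zero_mem_freqBall N⟩ rfl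
  have hfloor := power_ge_of_calm_zero hN hν hc hz h0 hE
  have hpi := Real.pi_pos
  have hsq : 0 ≤ Real.sqrt E := Real.sqrt_nonneg E
  have h8 : 8 * Real.pi ^ 3 * ν ^ 2 * Real.sqrt E ≤ Real.pi * ν / 2 := by
    have := mul_le_mul_of_nonneg_left hsmall (by positivity : (0 : ℝ) ≤ Real.pi * ν / 2)
    nlinarith
  linarith

end Summit.AnomalousDissipation.AnomalousDissipation.Theorems.CyclicWindLineLoud.PowerFloor

end
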